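import Literature.Barriers.ValiantsHypothesis.NotViaSaturationsBCI
import Literature.Barriers.ValiantsHypothesis.NotViaSaturationsProofs
import Literature.NumberTheory.DiophantineGeometry.KroneckerRectangularStability
import HarnessLib

/-!
# BCI Thm. 1(2) is equivalent to its rectangular case (the extreme rays of the Kronecker cone)

Third companion of `Literature/Barriers/ValiantsHypothesis/NotViaSaturations.lean`, about the named
fact `Literature.Barriers.ValiantsHypothesis.BCI2011_thm1` (Bürgisser–Christandl–Ikenmeyer 2011,
Thm. 1(2): for `λ ⊢ ℓd` with at most `d²` parts some stretching `g(kλ, k□, k□) ≠ 0`, `□ = (ℓ^d)`).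

`BCI2011_thm1_iff_rectangular`: the statement for all `λ` is EQUIVALENT to the statement for the
rectangular shapes `λ = (d^j)`, `1 ≤ j ≤ d²` (i.e. `ℓ = j`), which reads: for some `k ≥ 1` the
Kronecker coefficient of the three rectangles `j × kd`, `d × kj`, `d × kj` is nonzero. One direction
is specialisation. Conversely, write `λ = ∑_j (λ_j − λ_{j+1}) · (1^j)` (column decomposition; in
weight coordinates this is the telescoping `eq_sum_range_tsub_mul_indicator` of the Kumar file,
and the weight of a rectangle is `ofPartition_rectangle_eq` of `KroneckerRectangularStability.lean`);
with `K` the product of the stretching factors `k_j` of the `d²` rectangular instances, stability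
(`kroneckerCoeff_pos_partitionStretch`) makes every `(Kd · (1^j), (Kj)^d, (Kj)^d)` a positive triple,
and the semigroup property (row-wise sums, `Nat.Partition.rowAdd`,
`ikenmeyerPanova2017_semigroup_holds`) adds `λ_j − λ_{j+1}` copies of the `j`-th of them up to
`(Kd · λ, (Kdℓ)^d, (Kdℓ)^d) = (kλ, k□, k□)` with `k = Kd`. This is the convexity mechanism of
Christandl–Harrow–Mitchison §6 ("the semigroup property implies ... `Kron` is convex") run on the
extreme rays `(1^j)` of the cone of decreasing sequences with at most `d²` entries; it reduces BCI
Thm. 1(2) to a two-parameter family of three-rectangle positivity statements.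

## References

* P. Bürgisser, M. Christandl, C. Ikenmeyer, Adv. Math. 227 (2011) = arXiv:0910.4512, Thm. 1(2).
  [BurgisserChristandlIkenmeyer2011]
* M. Christandl, A. W. Harrow, G. Mitchison, Comm. Math. Phys. 270 (2007), Thm. 3.1 and §6.
  [ChristandlHarrowMitchison2007]
-/

noncomputable section

open scoped BigOperators

namespace Literature.Barriers.ValiantsHypothesis

open Literature.NumberTheory.DiophantineGeometry Literature.Computability.Complexity Finset

/-! ### Rectangles of size `d·j` with `j` rows -/

/-- `∑_{r<j} d = d·j`: the row sum of the `j`-row shape `(d^j)` (the rectangular `λ` of BCI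
Thm. 1(2), built below with `partitionOfRows` in the type `Nat.Partition (d * j)`). [folklore] -/
theorem sum_range_const_eq (d j : ℕ) : ∑ _r ∈ range j, d = d * j := by
  rw [sum_const, card_range, smul_eq_mul, mul_comm]

/-- The weight of the `j`-row partition of `d·j` with rows `d`: `d` on the first `j` coordinates.
[folklore] -/
theorem ofPartition_partitionOfRows_const (N d j : ℕ) :
    Weight.ofPartition N (partitionOfRows (fun _ => d) j (d * j)) =
      fun i : Fin N => if (i : ℕ) < j then (d : ℤ) else 0 := by
  rw [ofPartition_partitionOfRows (fun _ _ _ => le_rfl) (sum_range_const_eq d j)]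
  funext i
  split_ifs <;> simp

/-- The `j`-row partition of `d·j` with rows `d` has the parts of the rectangle `j × d`. [folklore] -/
theorem parts_partitionOfRows_const (d j : ℕ) :
    (partitionOfRows (fun _ => d) j (d * j)).parts = (Nat.Partition.rectangle j d).parts := by
  refine parts_eq_of_ofPartition_eq' (N := j) ?_
    (card_parts_partitionOfRows_le (fun _ _ _ => le_rfl) (sum_range_const_eq d j))
    (Nat.Partition.card_parts_rectangle_le j d)
  rw [ofPartition_partitionOfRows_const, ofPartition_rectangle_eq]

/-! ### The equivalence -/

/-- **BCI Thm. 1(2) ⇔ its rectangular case.** The right-hand side is `BCI2011_thm1` restricted to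
`ℓ = j ≤ d²` and `λ = (d^j)` (written as "every `λ ⊢ d·j` with the parts of the rectangle `j × d`",
which avoids a transport between `Nat.Partition (j * d)` and `Nat.Partition (d * j)`): for some
`k ≥ 1`, `g(j × kd, d × kj, d × kj) ≠ 0`. (⇒) is specialisation; (⇐) is the column decomposition
`λ = ∑_j (λ_j − λ_{j+1})(1^j)` fed through stability and the semigroup property, with the common
stretching factor `k = d ∏_j k_j`. [cite: BurgisserChristandlIkenmeyer2011, Thm. 1(2)] -/
theorem BCI2011_thm1_iff_rectangular :
    BCI2011_thm1 ↔
      ∀ (d : ℕ), 1 ≤ d → ∀ (j : ℕ), 1 ≤ j → j ≤ d ^ 2 →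
        ∀ lam : Nat.Partition (d * j), lam.parts = (Nat.Partition.rectangle j d).parts →
          ∃ k : ℕ, 1 ≤ k ∧
            kroneckerCoeff ℂ (partitionStretch k lam) (partitionStretch k (Nat.Partition.rectangle d j))
              (partitionStretch k (Nat.Partition.rectangle d j)) ≠ 0 := by
  constructor
  · intro h d hd j hj hjd lam hlam
    refine h j d hj hd lam ?_
    rw [hlam]
    exact (Nat.Partition.card_parts_rectangle_le j d).trans hjd
  intro h ℓ d hℓ hd lam hlam
  -- notation
  set N : ℕ := d * d with hN
  have hNsq : d ^ 2 = N := sq d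
  have hlamN : lam.parts.card ≤ N := by simpa [hNsq] using hlam
  -- the rectangular instances `j+1`, `j < N`, with their stretching factors
  have hinst : ∀ j : Fin N, ∃ k : ℕ, 1 ≤ k ∧
      kroneckerCoeff ℂ (partitionStretch k (partitionOfRows (fun _ => d) ((j : ℕ) + 1) (d * ((j : ℕ) + 1))))
        (partitionStretch k (Nat.Partition.rectangle d ((j : ℕ) + 1)))
        (partitionStretch k (Nat.Partition.rectangle d ((j : ℕ) + 1))) ≠ 0 :=
    fun j => h d hd _ (Nat.succ_pos _) (by rw [hNsq]; exact j.2) _ (parts_partitionOfRows_const d _)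
  choose kf hk1 hkg using hinst
  set K : ℕ := ∏ j, kf j with hK
  have hK1 : 1 ≤ K := Nat.one_le_iff_ne_zero.mpr (Finset.prod_ne_zero_iff.mpr fun j _ => Nat.one_le_iff_ne_zero.mp (hk1 j))
  have hdvd : ∀ j, kf j ∣ K := fun j => Finset.dvd_prod_of_mem _ (Finset.mem_univ j)
  have hqk : ∀ j, K / kf j * kf j = K := fun j => Nat.div_mul_cancel (hdvd j)
  -- multiplicities `a_j = λ_{j+1} − λ_{j+2}` (0-indexed rows `λ_0 ≥ λ_1 ≥ ⋯`)
  let row : ℕ → ℕ := fun r => lam.sortedParts.getD r 0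
  have hrow : Antitone row := antitone_getD_sortedParts lam
  have hrowN : row N = 0 := getD_sortedParts_eq_zero lam hlamN
  let a : ℕ → ℕ := fun j => row j - row (j + 1)
  -- the summands: `a_j · (K/k_j) · k_j`-fold stretches of the rectangular instances
  let S₁ : ∀ j : Fin N, Nat.Partition (a j * (K / kf j) * (kf j * (d * ((j : ℕ) + 1)))) := fun j =>
    partitionStretch (a j * (K / kf j))
      (partitionStretch (kf j) (partitionOfRows (fun _ => d) ((j : ℕ) + 1) (d * ((j : ℕ) + 1))))
  let S₂ : ∀ j : Fin N, Nat.Partition (a j * (K / kf j) * (kf j * (d * ((j : ℕ) + 1)))) := fun j =>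
    partitionStretch (a j * (K / kf j)) (partitionStretch (kf j) (Nat.Partition.rectangle d ((j : ℕ) + 1)))
  have hSpos : ∀ j, 0 < kroneckerCoeff ℂ (S₁ j) (S₂ j) (S₂ j) := fun j =>
    kroneckerCoeff_pos_partitionStretch _ (Nat.pos_of_ne_zero (hkg j))
  have hS₁w : ∀ j : Fin N, Weight.ofPartition N (S₁ j) =
      fun i : Fin N => if (i : ℕ) < (j : ℕ) + 1 then ((a j * K * d : ℕ) : ℤ) else 0 := by
    intro j
    change Weight.ofPartition N (partitionStretch _ (partitionStretch _ _)) = _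
    rw [ofPartition_partitionStretch, ofPartition_partitionStretch, ofPartition_partitionOfRows_const,
      smul_smul, mul_assoc, hqk j]
    funext i
    simp only [Pi.smul_apply, nsmul_eq_mul]
    split_ifs <;> push_cast <;> ring
  have hS₂w : ∀ j : Fin N, Weight.ofPartition N (S₂ j) =
      fun i : Fin N => if (i : ℕ) < d then ((a j * K * ((j : ℕ) + 1) : ℕ) : ℤ) else 0 := by
    intro j
    change Weight.ofPartition N (partitionStretch _ (partitionStretch _ _)) = _
    rw [ofPartition_partitionStretch, ofPartition_partitionStretch, ofPartition_rectangle_eq, smul_smul,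
      mul_assoc, hqk j]
    funext i
    simp only [Pi.smul_apply, nsmul_eq_mul]
    split_ifs <;> push_cast <;> ring
  have hS₁c : ∀ j : Fin N, (S₁ j).parts.card ≤ N := fun j =>
    (card_parts_partitionStretch_le _ _).trans ((card_parts_partitionStretch_le _ _).trans
      ((card_parts_partitionOfRows_le (fun _ _ _ => le_rfl) (sum_range_const_eq d _)).trans j.2))
  have hS₂c : ∀ j : Fin N, (S₂ j).parts.card ≤ N := fun j =>
    (card_parts_partitionStretch_le _ _).trans ((card_parts_partitionStretch_le _ _).trans
      ((Nat.Partition.card_parts_rectangle_le d _).trans (Nat.le_mul_self d)))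
  -- the weights as functions of `j : ℕ`
  let W₁ : ℕ → Weight (Fin N) := fun j i =>
    if j < N ∧ (i : ℕ) < j + 1 then ((a j * K * d : ℕ) : ℤ) else 0
  let W₂ : ℕ → Weight (Fin N) := fun j i =>
    if j < N ∧ (i : ℕ) < d then ((a j * K * (j + 1) : ℕ) : ℤ) else 0
  have hW₁ : ∀ j : Fin N, Weight.ofPartition N (S₁ j) = W₁ j := fun j => by
    rw [hS₁w]; funext i; simp only [W₁, j.2, true_and]
  have hW₂ : ∀ j : Fin N, Weight.ofPartition N (S₂ j) = W₂ j := fun j => by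
    rw [hS₂w]; funext i; simp only [W₂, j.2, true_and]
  -- fold the summands with the semigroup property
  have fold : ∀ J : ℕ, J ≤ N → ∃ (n : ℕ) (L M : Nat.Partition n), L.parts.card ≤ N ∧ M.parts.card ≤ N ∧
      Weight.ofPartition N L = ∑ j ∈ range J, W₁ j ∧ Weight.ofPartition N M = ∑ j ∈ range J, W₂ j ∧
      0 < kroneckerCoeff ℂ L M M := by
    intro J
    induction J with
    | zero =>
      intro _
      refine ⟨0, Nat.Partition.indiscrete 0, Nat.Partition.indiscrete 0, by simp, by simp, ?_, ?_,
        kroneckerCoeff_pos_of_eq_zero rfl _ _ _⟩ <;>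
      · funext i
        rw [sum_range_zero, Weight.ofPartition_apply]
        simp [Nat.Partition.sortedParts]
    | succ J ih =>
      intro hJ
      obtain ⟨n, L, M, hLc, hMc, hLw, hMw, hpos⟩ := ih (Nat.le_of_succ_le hJ)
      have hJN : J < N := hJ
      refine ⟨_, L.rowAdd (S₁ ⟨J, hJN⟩), M.rowAdd (S₂ ⟨J, hJN⟩), ?_, ?_, ?_, ?_,
        ikenmeyerPanova2017_semigroup_holds _ _ _ _ _ _ hpos (hSpos ⟨J, hJN⟩)⟩
      · exact (card_parts_rowAdd_le _ _).trans (max_le hLc (hS₁c _))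
      · exact (card_parts_rowAdd_le _ _).trans (max_le hMc (hS₂c _))
      · rw [ofPartition_rowAdd, hLw, hW₁, sum_range_succ]
      · rw [ofPartition_rowAdd, hMw, hW₂, sum_range_succ]
  obtain ⟨n, L, M, hLc, hMc, hLw, hMw, hpos⟩ := fold N le_rfl
  -- identify the total weights: `∑_j W₁ j = (Kd) • weight(λ)` by telescoping
  have hLw' : Weight.ofPartition N L = Weight.ofPartition N (partitionStretch (K * d) lam) := by
    rw [hLw, ofPartition_partitionStretch]
    funext i
    rw [Finset.sum_apply, Pi.smul_apply, Weight.ofPartition_apply, nsmul_eq_mul,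
      eq_sum_range_tsub_mul_indicator (m := N) hrow hrowN i, mul_sum]
    refine sum_congr rfl fun j hj => ?_
    rw [mem_range] at hj
    simp only [W₁, hj, true_and]
    by_cases hij : (i : ℕ) ≤ j
    · rw [if_pos (Nat.lt_succ_of_le hij), if_pos hij]
      push_cast; ring
    · rw [if_neg (fun h' => hij (Nat.le_of_lt_succ h')), if_neg hij]
      ring
  -- sizes: `n = (Kd)(dℓ)`
  have hn : n = K * d * (d * ℓ) :=
    size_eq_of_ofPartition_eq hLw' hLc ((card_parts_partitionStretch_le _ _).trans hlamN)
  -- `∑_j W₂ j = c' • 𝟙_{[d]}` with `c' d = n`, hence `c' = K d ℓ`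
  set c' : ℕ := ∑ j ∈ range N, a j * K * (j + 1) with hc'
  have hMw1 : Weight.ofPartition N M = fun i : Fin N => if (i : ℕ) < d then (c' : ℤ) else 0 := by
    rw [hMw]
    funext i
    rw [Finset.sum_apply]
    by_cases hi : (i : ℕ) < d
    · rw [if_pos hi, hc', Nat.cast_sum]
      refine sum_congr rfl fun j hj => ?_
      rw [mem_range] at hj
      simp only [W₂, hj, hi, and_self, if_true]
    · rw [if_neg hi]
      refine sum_eq_zero fun j hj => ?_
      simp only [W₂, hi, and_false, if_false]
  have hdN : d ≤ N := Nat.le_mul_self d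
  have hsizeM : ∑ i : Fin N, Weight.ofPartition N M i = n := Weight.size_ofPartition_holds hMc
  have hc'd : (c' : ℤ) * d = n := by
    rw [← hsizeM, hMw1, Fin.sum_univ_eq_sum_range (fun i => if i < d then (c' : ℤ) else 0) N,
      ← sum_range_add_sum_Ico _ hdN]
    have h1 : ∑ i ∈ range d, (if i < d then (c' : ℤ) else 0) = ∑ _i ∈ range d, (c' : ℤ) :=
      sum_congr rfl fun i hi => if_pos (mem_range.mp hi)
    have h2 : ∑ i ∈ Ico d N, (if i < d then (c' : ℤ) else 0) = 0 :=
      sum_eq_zero fun i hi => if_neg (not_lt.mpr (mem_Ico.mp hi).1)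
    rw [h1, h2, add_zero, sum_const, card_range, nsmul_eq_mul]
    ring
  have hc'eq : c' = K * d * ℓ := by
    have h1 : (c' : ℤ) * d = (K * d * ℓ : ℕ) * d := by rw [hc'd, hn]; push_cast; ring
    have hd0 : (d : ℤ) ≠ 0 := by exact_mod_cast (show d ≠ 0 by omega)
    exact_mod_cast mul_right_cancel₀ hd0 h1
  have hMw' : Weight.ofPartition N M =
      Weight.ofPartition N (partitionStretch (K * d) (Nat.Partition.rectangle d ℓ)) := by
    rw [hMw1, ofPartition_partitionStretch, ofPartition_rectangle_eq, hc'eq]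
    funext i
    simp only [Pi.smul_apply, nsmul_eq_mul]
    split_ifs <;> push_cast <;> ring
  -- transport and conclude
  have hrc : (partitionStretch (K * d) (Nat.Partition.rectangle d ℓ)).parts.card ≤ N :=
    (card_parts_partitionStretch_le _ _).trans ((Nat.Partition.card_parts_rectangle_le d ℓ).trans hdN)
  rw [kroneckerCoeff_congr_parts hn (parts_eq_of_ofPartition_eq' hLw' hLc
      ((card_parts_partitionStretch_le _ _).trans hlamN))
    (parts_eq_of_ofPartition_eq' hMw' hMc hrc) (parts_eq_of_ofPartition_eq' hMw' hMc hrc)] at hpos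
  exact ⟨K * d, Nat.mul_pos hK1 hd, hpos.ne'⟩

end Literature.Barriers.ValiantsHypothesis
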